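import Summits.HodgeConjecture.HodgeConjecture.Theorems.F0P2dStubHProjectedL2Data
import Summits.HodgeConjecture.HodgeConjecture.Theorems.F0P2dStubT
import Summits.HodgeConjecture.HodgeConjecture.Theorems.P2StubGHolGermOfWeak
import Summits.HodgeConjecture.HodgeConjecture.Theorems.P2H413OfSockets
import HarnessLib

/-!
# Crux `H413`, (D) desk — THEOREMS-LEVEL ASSEMBLY of the sub-line `F0_P2SpectralProjectionD`: the (D) socket
# `CotangentForms.holCotFormSpectralProjection` BY NAME from the three ★ closers (H) (T) (G) and the three outstanding stubs (K) (S) (R)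
# taken as hypotheses IN THEIR REGISTERED, BUNDLE-UNFOLDED SHAPES

Cell hodgecm-mathlib (D-0151), FLOOR 0, crux item H413 = stmt-HodgeConjecture-24833; programme P2; sub-line of record
`Cruxes/H413/Lines/F0_P2SpectralProjectionD.lean` v1.1 (F0P2-plan (g2), sha16 e1fa5bd1360092b6; head `holCotFormSpectralProjection_of`).  Author F0P2-p01 (g2).
THEOREMS ONLY (no `def`, no `sorry`); `--supports stmt-HodgeConjecture-24833 --as helper`.  HC_CM is proved only modulo the 7 printed citations until rung 0
closes; this file proves nothing about them.

WHY THIS FILE (ref1 N28-3; probe 2026-08-31T00:1xZ: the farm does not build `Cruxes/…/Lines` modules — `import …Lines.F0_P2SpectralProjectionD` answers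
`stale:unbuilt` — so the sub-line's head cannot be folded into the parent line by a Lines→Lines import): the head is re-proved HERE, at Theorems level, where the
six closers live.  The three stubs that are ★ are consumed BY NAME — (H) `F0P2dStubHProjectedL2Data.stubHProjectedL2Data_holds` (A-p06 (g18), p797557), (T)
`F0P2dStubT.stubT_holds` (F0P2-p02 (g2), p797536), (G) `P2StubGHolGermOfWeak.isHolGerm_of_weaklyHol` (F0P2-p01 (g2), p797242); the three outstanding ones —
(K) `StubKReproducingKernel` (p03 (g2)), (S) `StubSCotFormL2Data` (A-p18 (g16)), (R) `StubRRegularOfReproduced` (F0P2-p04 (g2)) — are HYPOTHESES stated in the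
registered shape with the Lines-local bundles unfolded by the cell's convention (s347): `G3 L H` ↦ `adelicGroupData L⁺ L c̄ 3 H`; `IsRegularKernel A` ↦ the
conjunction of its four fields (p03's announced closer type, 00:17:34Z); `IsReproducedAlong` unfolded; `IsL2CotPair` ↦ the conjunction of its six fields in
declaration order with `kernelOp`∕`orbitP`∕`IsWeaklyHol` unfolded (A-p06's (H) output shape); `Realises` ↦ the conjunction of its six fields (p02's (T) input
shape).  When (K)∕(S)∕(R) land, `holCotFormSpectralProjection_holds` is the 5-line successor discharging `hK hS hR` by name (glue = re-bracketing at most).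

* `holCotFormSpectralProjection_of_KSR (hK) (hS) (hR) : holCotFormSpectralProjection` — the head, ported;
* `H413_of_KSR (hK) (hS) (hR) (hC) (hC') (hU4) (hJ3a) (hocc)` — the crux BY NAME via ★ `P2H413OfSockets.H413_of_sockets'` (p795208).

## References
* [BorelJacquet1979] A. Borel, H. Jacquet, Corvallis PSPM 33.1 (1979), §4.2, §4.6.  [Borel1997] A. Borel, *Automorphic forms on SL₂(ℝ)* (1997), Thm. 2.13, §5.14, §8.4.
* [Liu2021] Y. Liu et al., Prop. 4.13, Rem. 4.14.  [Rogawski1990] J. Rogawski, Thm. 13.3.1.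
-/

set_option autoImplicit false

-- the mandated namespace has the single-problem summit's repeated segment (`HodgeConjecture.HodgeConjecture`)
set_option linter.dupNamespace false

noncomputable section

namespace Summit.HodgeConjecture.HodgeConjecture.Cruxes.H413.F0P2dSocketDOfStubs

open scoped Matrix ComplexOrder ContDiff
open MeasureTheory NumberField MulAction
open Literature.NumberTheory.Automorphic Literature.NumberTheory.Automorphic.UnitaryGroup
open Literature.NumberTheory.Automorphic.UnitaryGroup.CotangentForms
open Literature.AlgebraicGeometry.ShimuraVarieties
open Literature.Geometry.ComplexHyperbolic.BallModel (U21 x₀)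
open Summit.HodgeConjecture.HodgeConjecture.Cruxes.H413.SpectrumInterfaces (StubU4SignRule HJ3aType HoccType)

/-- **HEAD, PORTED — (D) `holCotFormSpectralProjection` from (K), (S), (R) as hypotheses (registered shapes, bundles unfolded) and the ★ closers (H), (T), (G) by
name.**  Plumbing only, verbatim the Lines head `holCotFormSpectralProjection_of`: Haar `ν` on `U(2,1)` and the kernel `A` of (K); `u := [Φ]` (S) ↦ `w := pr_P ∘ u` (H) ↦
regular representatives `Ψ` of the reproduced pair (R) ↦ holomorphic germs (G) ↦ `Ψ ∈ holCotForms` (T); the classes agree by `Realises.aeEq`.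
[cite: BorelJacquet1979, §4.6] [cite: Borel1997, Thm. 2.13] -/
theorem holCotFormSpectralProjection_of_KSR
    (hK : ∀ (ν : Measure ↥U21) [ν.IsHaarMeasure], ∃ A : ↥U21 → Matrix (Fin 2) (Fin 2) ℂ,
        (Continuous A ∧ HasCompactSupport A ∧
          (∀ (j i : Fin 2) (u' : ↥U21), ContDiff ℝ 1 fun b : Fin 2 → ℂ => A (BallForms.expP b * u') j i) ∧
          ∀ j i : Fin 2, Continuous fun p : (Fin 2 → ℂ) × ↥U21 => fderiv ℝ (fun b : Fin 2 → ℂ => A (BallForms.expP b * p.2) j i) p.1) ∧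
        (∀ (G : Type) [Group G] (ιG : ↥U21 →* G) (Φ : G → (Fin 2 → ℂ)),
          (∀ (k : stabilizer (↥U21) x₀) (g : G), Φ (g * ιG k) = BallForms.isPullbackCocycle_cotangentCocycle.weightOf x₀ k⁻¹ (Φ g)) →
          IsHolGerm ιG Φ → ∀ y : G, ∫ u, A u *ᵥ Φ (y * ιG u) ∂ν = Φ y))
    (hS : ∀ (L : Type) [Field L] [NumberField L] [IsCMField L] (ι : L →+* ℂ) (H : Matrix (Fin 3) (Fin 3) L) (T : GL (Fin 3) ℂ)
      (hT : (T : Matrix (Fin 3) (Fin 3) ℂ)ᴴ * H.map ι * (T : Matrix (Fin 3) (Fin 3) ℂ) = Literature.Geometry.ComplexHyperbolic.BallModel.J),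
      (∀ τ' : L →+* ℂ, InfinitePlace.mk τ' ≠ InfinitePlace.mk ι → (H.map τ').PosDef) →
      2 ≤ Module.finrank ℚ ↥(maximalRealSubfield L) →
      ∀ (μ : Measure (adelicGroupData (↥(maximalRealSubfield L)) L (IsCMField.complexConj L) 3 H).automorphicQuotient)
        [(adelicGroupData (↥(maximalRealSubfield L)) L (IsCMField.complexConj L) 3 H).IsAutomorphicMeasure μ]
        (ν : Measure ↥U21) [ν.IsHaarMeasure] (A : ↥U21 → Matrix (Fin 2) (Fin 2) ℂ),
        (Continuous A ∧ HasCompactSupport A ∧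
          (∀ (j i : Fin 2) (u' : ↥U21), ContDiff ℝ 1 fun b : Fin 2 → ℂ => A (BallForms.expP b * u') j i) ∧
          ∀ j i : Fin 2, Continuous fun p : (Fin 2 → ℂ) × ↥U21 => fderiv ℝ (fun b : Fin 2 → ℂ => A (BallForms.expP b * p.2) j i) p.1) →
        (∀ Φ : (adelicGroupData (↥(maximalRealSubfield L)) L (IsCMField.complexConj L) 3 H).Adelic → (Fin 2 → ℂ),
          (∀ (k : stabilizer (↥U21) x₀) (g : (adelicGroupData (↥(maximalRealSubfield L)) L (IsCMField.complexConj L) 3 H).Adelic),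
            Φ (g * cmArchSection L ι H T hT k) = BallForms.isPullbackCocycle_cotangentCocycle.weightOf x₀ k⁻¹ (Φ g)) →
          IsHolGerm (cmArchSection L ι H T hT) Φ →
            ∀ y : (adelicGroupData (↥(maximalRealSubfield L)) L (IsCMField.complexConj L) 3 H).Adelic, ∫ u, A u *ᵥ Φ (y * cmArchSection L ι H T hT u) ∂ν = Φ y) →
      ∀ (Φ : (adelicGroupData (↥(maximalRealSubfield L)) L (IsCMField.complexConj L) 3 H).Adelic → (Fin 2 → ℂ)), Φ ∈ holCotForms (↥(maximalRealSubfield L)) L (IsCMField.complexConj L) 3 H (cmArchSection L ι H T hT) (cmCompactFactor L ι H T hT) →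
      ∀ hΦ : ∀ j : Fin 2, MemLp (toQuotFun (adelicGroupData (↥(maximalRealSubfield L)) L (IsCMField.complexConj L) 3 H) fun g => Φ g j) 2 μ,
        (∀ j, (∑ i : Fin 2, ∫ t, A t j i • (adelicGroupData (↥(maximalRealSubfield L)) L (IsCMField.complexConj L) 3 H).rightRegular μ (cmArchSection L ι H T hT t) (MemLp.toLp (toQuotFun (adelicGroupData (↥(maximalRealSubfield L)) L (IsCMField.complexConj L) 3 H) fun g => Φ g i) (hΦ i)) ∂ν) = (MemLp.toLp (toQuotFun (adelicGroupData (↥(maximalRealSubfield L)) L (IsCMField.complexConj L) 3 H) fun g => Φ g j) (hΦ j))) ∧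
        (∀ k ∈ cmCompactFactor L ι H T hT, ∀ j, (adelicGroupData (↥(maximalRealSubfield L)) L (IsCMField.complexConj L) 3 H).rightRegular μ k (MemLp.toLp (toQuotFun (adelicGroupData (↥(maximalRealSubfield L)) L (IsCMField.complexConj L) 3 H) fun g => Φ g j) (hΦ j)) = (MemLp.toLp (toQuotFun (adelicGroupData (↥(maximalRealSubfield L)) L (IsCMField.complexConj L) 3 H) fun g => Φ g j) (hΦ j))) ∧
        (∃ Kf : Subgroup (finAdelic (↥(maximalRealSubfield L)) L (IsCMField.complexConj L) 3 H), IsOpen (Kf : Set (finAdelic (↥(maximalRealSubfield L)) L (IsCMField.complexConj L) 3 H)) ∧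
          ∀ k ∈ Kf, ∀ j, (adelicGroupData (↥(maximalRealSubfield L)) L (IsCMField.complexConj L) 3 H).rightRegular μ (finAdelicToAdelic (↥(maximalRealSubfield L)) L (IsCMField.complexConj L) 3 H k) (MemLp.toLp (toQuotFun (adelicGroupData (↥(maximalRealSubfield L)) L (IsCMField.complexConj L) 3 H) fun g => Φ g j) (hΦ j)) = (MemLp.toLp (toQuotFun (adelicGroupData (↥(maximalRealSubfield L)) L (IsCMField.complexConj L) 3 H) fun g => Φ g j) (hΦ j))) ∧
        (∀ (k : stabilizer (↥U21) x₀) (j : Fin 2), (adelicGroupData (↥(maximalRealSubfield L)) L (IsCMField.complexConj L) 3 H).rightRegular μ (cmArchSection L ι H T hT k) (MemLp.toLp (toQuotFun (adelicGroupData (↥(maximalRealSubfield L)) L (IsCMField.complexConj L) 3 H) fun g => Φ g j) (hΦ j)) =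
          ∑ i : Fin 2, (BallForms.isPullbackCocycle_cotangentCocycle.weightOf x₀ k⁻¹ (Pi.single i 1)) j • (MemLp.toLp (toQuotFun (adelicGroupData (↥(maximalRealSubfield L)) L (IsCMField.complexConj L) 3 H) fun g => Φ g i) (hΦ i))) ∧
        (∀ j, DifferentiableAt ℝ (fun b : Fin 2 → ℂ => (adelicGroupData (↥(maximalRealSubfield L)) L (IsCMField.complexConj L) 3 H).rightRegular μ (cmArchSection L ι H T hT (BallForms.expP b)) (MemLp.toLp (toQuotFun (adelicGroupData (↥(maximalRealSubfield L)) L (IsCMField.complexConj L) 3 H) fun g => Φ g j) (hΦ j))) 0) ∧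
        (∀ j, ∀ b : Fin 2 → ℂ,
          fderiv ℝ (fun b : Fin 2 → ℂ => (adelicGroupData (↥(maximalRealSubfield L)) L (IsCMField.complexConj L) 3 H).rightRegular μ (cmArchSection L ι H T hT (BallForms.expP b)) (MemLp.toLp (toQuotFun (adelicGroupData (↥(maximalRealSubfield L)) L (IsCMField.complexConj L) 3 H) fun g => Φ g j) (hΦ j))) 0 (Complex.I • b) =
            Complex.I • fderiv ℝ (fun b : Fin 2 → ℂ => (adelicGroupData (↥(maximalRealSubfield L)) L (IsCMField.complexConj L) 3 H).rightRegular μ (cmArchSection L ι H T hT (BallForms.expP b)) (MemLp.toLp (toQuotFun (adelicGroupData (↥(maximalRealSubfield L)) L (IsCMField.complexConj L) 3 H) fun g => Φ g j) (hΦ j))) 0 b))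
    (hR : ∀ (L : Type) [Field L] [NumberField L] [IsCMField L] (ι : L →+* ℂ) (H : Matrix (Fin 3) (Fin 3) L) (T : GL (Fin 3) ℂ)
      (hT : (T : Matrix (Fin 3) (Fin 3) ℂ)ᴴ * H.map ι * (T : Matrix (Fin 3) (Fin 3) ℂ) = Literature.Geometry.ComplexHyperbolic.BallModel.J),
      (∀ τ' : L →+* ℂ, InfinitePlace.mk τ' ≠ InfinitePlace.mk ι → (H.map τ').PosDef) →
      2 ≤ Module.finrank ℚ ↥(maximalRealSubfield L) →
      ∀ (μ : Measure (adelicGroupData (↥(maximalRealSubfield L)) L (IsCMField.complexConj L) 3 H).automorphicQuotient)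
        [(adelicGroupData (↥(maximalRealSubfield L)) L (IsCMField.complexConj L) 3 H).IsAutomorphicMeasure μ]
        (ν : Measure ↥U21) [ν.IsHaarMeasure] (A : ↥U21 → Matrix (Fin 2) (Fin 2) ℂ),
        (Continuous A ∧ HasCompactSupport A ∧
          (∀ (j i : Fin 2) (u' : ↥U21), ContDiff ℝ 1 fun b : Fin 2 → ℂ => A (BallForms.expP b * u') j i) ∧
          ∀ j i : Fin 2, Continuous fun p : (Fin 2 → ℂ) × ↥U21 => fderiv ℝ (fun b : Fin 2 → ℂ => A (BallForms.expP b * p.2) j i) p.1) →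
      ∀ (w : Fin 2 → (adelicGroupData (↥(maximalRealSubfield L)) L (IsCMField.complexConj L) 3 H).L2 μ),
        (∀ j, (∑ i : Fin 2, ∫ t, A t j i • (adelicGroupData (↥(maximalRealSubfield L)) L (IsCMField.complexConj L) 3 H).rightRegular μ (cmArchSection L ι H T hT t) (w i) ∂ν) = w j) →
        (∀ k ∈ cmCompactFactor L ι H T hT, ∀ j, (adelicGroupData (↥(maximalRealSubfield L)) L (IsCMField.complexConj L) 3 H).rightRegular μ k (w j) = w j) →
        (∃ Kf : Subgroup (finAdelic (↥(maximalRealSubfield L)) L (IsCMField.complexConj L) 3 H), IsOpen (Kf : Set (finAdelic (↥(maximalRealSubfield L)) L (IsCMField.complexConj L) 3 H)) ∧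
          ∀ k ∈ Kf, ∀ j, (adelicGroupData (↥(maximalRealSubfield L)) L (IsCMField.complexConj L) 3 H).rightRegular μ (finAdelicToAdelic (↥(maximalRealSubfield L)) L (IsCMField.complexConj L) 3 H k) (w j) = w j) →
        ∃ Ψ : Fin 2 → ((adelicGroupData (↥(maximalRealSubfield L)) L (IsCMField.complexConj L) 3 H).Adelic → ℂ), ∀ j,
          (∀ γ ∈ (adelicGroupData (↥(maximalRealSubfield L)) L (IsCMField.complexConj L) 3 H).quotientSubgroup, ∀ x, Ψ j (γ * x) = Ψ j x) ∧
            Continuous (Ψ j) ∧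
            toQuotFun (adelicGroupData (↥(maximalRealSubfield L)) L (IsCMField.complexConj L) 3 H) (Ψ j) =ᵐ[μ] (w j : (adelicGroupData (↥(maximalRealSubfield L)) L (IsCMField.complexConj L) 3 H).automorphicQuotient → ℂ) ∧
            (∀ y, DifferentiableAt ℝ (fun b : Fin 2 → ℂ => Ψ j (y * cmArchSection L ι H T hT (BallForms.expP b))) 0) ∧
            (∀ b : Fin 2 → ℂ, Continuous fun y => fderiv ℝ (fun b : Fin 2 → ℂ => Ψ j (y * cmArchSection L ι H T hT (BallForms.expP b))) 0 b) ∧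
            ∀ b : Fin 2 → ℂ,
              toQuotFun (adelicGroupData (↥(maximalRealSubfield L)) L (IsCMField.complexConj L) 3 H) (fun y => fderiv ℝ (fun b : Fin 2 → ℂ => Ψ j (y * cmArchSection L ι H T hT (BallForms.expP b))) 0 b) =ᵐ[μ]
                ((fderiv ℝ (fun b : Fin 2 → ℂ => (adelicGroupData (↥(maximalRealSubfield L)) L (IsCMField.complexConj L) 3 H).rightRegular μ (cmArchSection L ι H T hT (BallForms.expP b)) (w j)) 0 b : (adelicGroupData (↥(maximalRealSubfield L)) L (IsCMField.complexConj L) 3 H).L2 μ) :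
                  (adelicGroupData (↥(maximalRealSubfield L)) L (IsCMField.complexConj L) 3 H).automorphicQuotient → ℂ)) :
    holCotFormSpectralProjection := by
  intro L _ _ _ ι H T hT hdef hrk μ _ P Φ hΦmem hΦ
  obtain ⟨A, hAreg, hArep⟩ := hK (Measure.haar (G := ↥U21))
  obtain ⟨hu1, hu2, hu3, hu4, hu5, hu6⟩ :=
    hS L ι H T hT hdef hrk μ Measure.haar A hAreg (hArep _ (cmArchSection L ι H T hT)) Φ hΦmem hΦ
  obtain ⟨hw1, hw2, hw3, hw4, hw5, hw6⟩ :=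
    F0P2dStubHProjectedL2Data.stubHProjectedL2Data_holds L ι H T hT μ Measure.haar A P _ hu1 hu2 hu3 hu4 hu5 hu6
  obtain ⟨Ψ, hΨ⟩ := hR L ι H T hT hdef hrk μ Measure.haar A hAreg _ hw1 hw2 hw3
  have hgerm : IsHolGerm (cmArchSection L ι H T hT) (fun x j => Ψ j x) :=
    P2StubGHolGermOfWeak.isHolGerm_of_weaklyHol (adelicGroupData (↥(maximalRealSubfield L)) L (IsCMField.complexConj L) 3 H) μ (cmArchSection L ι H T hT) _ Ψ
      (fun j => (hΨ j).1) (fun j => (hΨ j).2.2.2.1) (fun j => (hΨ j).2.2.2.2.1) (fun j => (hΨ j).2.2.2.2.2) hw6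
  have hmem := F0P2dStubT.stubT_holds L ι H T hT μ _ Ψ hΨ hw2 hw3 hw4 hgerm
  have hmemLp : ∀ j : Fin 2, MemLp (toQuotFun (adelicGroupData (↥(maximalRealSubfield L)) L (IsCMField.complexConj L) 3 H) fun g => Ψ j g) 2 μ :=
    fun j => (Lp.memLp _).ae_eq (hΨ j).2.2.1.symm
  refine ⟨fun x j => Ψ j x, hmem, hmemLp, fun j => ?_⟩
  refine (Lp.ext ?_).symm
  exact (MemLp.coeFn_toLp (hmemLp j)).trans (hΨ j).2.2.1

set_option synthInstance.maxHeartbeats 400000 in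
set_option maxHeartbeats 8000000 in
/-- **THE CRUX `HCCMUnconditional.H413` BY NAME from (K), (S), (R), the sockets (C), (C′), U4 and the floor rows `hJ3a`, `hocc`** via ★
`P2H413OfSockets.H413_of_sockets'` (p795208; (D̄) := (D)). [cite: Liu2021, Prop. 4.13 and Rem. 4.14] [cite: Rogawski1990, Thm. 13.3.1] -/
theorem H413_of_KSR
    (hK : ∀ (ν : Measure ↥U21) [ν.IsHaarMeasure], ∃ A : ↥U21 → Matrix (Fin 2) (Fin 2) ℂ,
        (Continuous A ∧ HasCompactSupport A ∧
          (∀ (j i : Fin 2) (u' : ↥U21), ContDiff ℝ 1 fun b : Fin 2 → ℂ => A (BallForms.expP b * u') j i) ∧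
          ∀ j i : Fin 2, Continuous fun p : (Fin 2 → ℂ) × ↥U21 => fderiv ℝ (fun b : Fin 2 → ℂ => A (BallForms.expP b * p.2) j i) p.1) ∧
        (∀ (G : Type) [Group G] (ιG : ↥U21 →* G) (Φ : G → (Fin 2 → ℂ)),
          (∀ (k : stabilizer (↥U21) x₀) (g : G), Φ (g * ιG k) = BallForms.isPullbackCocycle_cotangentCocycle.weightOf x₀ k⁻¹ (Φ g)) →
          IsHolGerm ιG Φ → ∀ y : G, ∫ u, A u *ᵥ Φ (y * ιG u) ∂ν = Φ y))
    (hS : ∀ (L : Type) [Field L] [NumberField L] [IsCMField L] (ι : L →+* ℂ) (H : Matrix (Fin 3) (Fin 3) L) (T : GL (Fin 3) ℂ)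
      (hT : (T : Matrix (Fin 3) (Fin 3) ℂ)ᴴ * H.map ι * (T : Matrix (Fin 3) (Fin 3) ℂ) = Literature.Geometry.ComplexHyperbolic.BallModel.J),
      (∀ τ' : L →+* ℂ, InfinitePlace.mk τ' ≠ InfinitePlace.mk ι → (H.map τ').PosDef) →
      2 ≤ Module.finrank ℚ ↥(maximalRealSubfield L) →
      ∀ (μ : Measure (adelicGroupData (↥(maximalRealSubfield L)) L (IsCMField.complexConj L) 3 H).automorphicQuotient)
        [(adelicGroupData (↥(maximalRealSubfield L)) L (IsCMField.complexConj L) 3 H).IsAutomorphicMeasure μ]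
        (ν : Measure ↥U21) [ν.IsHaarMeasure] (A : ↥U21 → Matrix (Fin 2) (Fin 2) ℂ),
        (Continuous A ∧ HasCompactSupport A ∧
          (∀ (j i : Fin 2) (u' : ↥U21), ContDiff ℝ 1 fun b : Fin 2 → ℂ => A (BallForms.expP b * u') j i) ∧
          ∀ j i : Fin 2, Continuous fun p : (Fin 2 → ℂ) × ↥U21 => fderiv ℝ (fun b : Fin 2 → ℂ => A (BallForms.expP b * p.2) j i) p.1) →
        (∀ Φ : (adelicGroupData (↥(maximalRealSubfield L)) L (IsCMField.complexConj L) 3 H).Adelic → (Fin 2 → ℂ),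
          (∀ (k : stabilizer (↥U21) x₀) (g : (adelicGroupData (↥(maximalRealSubfield L)) L (IsCMField.complexConj L) 3 H).Adelic),
            Φ (g * cmArchSection L ι H T hT k) = BallForms.isPullbackCocycle_cotangentCocycle.weightOf x₀ k⁻¹ (Φ g)) →
          IsHolGerm (cmArchSection L ι H T hT) Φ →
            ∀ y : (adelicGroupData (↥(maximalRealSubfield L)) L (IsCMField.complexConj L) 3 H).Adelic, ∫ u, A u *ᵥ Φ (y * cmArchSection L ι H T hT u) ∂ν = Φ y) →
      ∀ (Φ : (adelicGroupData (↥(maximalRealSubfield L)) L (IsCMField.complexConj L) 3 H).Adelic → (Fin 2 → ℂ)), Φ ∈ holCotForms (↥(maximalRealSubfield L)) L (IsCMField.complexConj L) 3 H (cmArchSection L ι H T hT) (cmCompactFactor L ι H T hT) →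
      ∀ hΦ : ∀ j : Fin 2, MemLp (toQuotFun (adelicGroupData (↥(maximalRealSubfield L)) L (IsCMField.complexConj L) 3 H) fun g => Φ g j) 2 μ,
        (∀ j, (∑ i : Fin 2, ∫ t, A t j i • (adelicGroupData (↥(maximalRealSubfield L)) L (IsCMField.complexConj L) 3 H).rightRegular μ (cmArchSection L ι H T hT t) (MemLp.toLp (toQuotFun (adelicGroupData (↥(maximalRealSubfield L)) L (IsCMField.complexConj L) 3 H) fun g => Φ g i) (hΦ i)) ∂ν) = (MemLp.toLp (toQuotFun (adelicGroupData (↥(maximalRealSubfield L)) L (IsCMField.complexConj L) 3 H) fun g => Φ g j) (hΦ j))) ∧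
        (∀ k ∈ cmCompactFactor L ι H T hT, ∀ j, (adelicGroupData (↥(maximalRealSubfield L)) L (IsCMField.complexConj L) 3 H).rightRegular μ k (MemLp.toLp (toQuotFun (adelicGroupData (↥(maximalRealSubfield L)) L (IsCMField.complexConj L) 3 H) fun g => Φ g j) (hΦ j)) = (MemLp.toLp (toQuotFun (adelicGroupData (↥(maximalRealSubfield L)) L (IsCMField.complexConj L) 3 H) fun g => Φ g j) (hΦ j))) ∧
        (∃ Kf : Subgroup (finAdelic (↥(maximalRealSubfield L)) L (IsCMField.complexConj L) 3 H), IsOpen (Kf : Set (finAdelic (↥(maximalRealSubfield L)) L (IsCMField.complexConj L) 3 H)) ∧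
          ∀ k ∈ Kf, ∀ j, (adelicGroupData (↥(maximalRealSubfield L)) L (IsCMField.complexConj L) 3 H).rightRegular μ (finAdelicToAdelic (↥(maximalRealSubfield L)) L (IsCMField.complexConj L) 3 H k) (MemLp.toLp (toQuotFun (adelicGroupData (↥(maximalRealSubfield L)) L (IsCMField.complexConj L) 3 H) fun g => Φ g j) (hΦ j)) = (MemLp.toLp (toQuotFun (adelicGroupData (↥(maximalRealSubfield L)) L (IsCMField.complexConj L) 3 H) fun g => Φ g j) (hΦ j))) ∧
        (∀ (k : stabilizer (↥U21) x₀) (j : Fin 2), (adelicGroupData (↥(maximalRealSubfield L)) L (IsCMField.complexConj L) 3 H).rightRegular μ (cmArchSection L ι H T hT k) (MemLp.toLp (toQuotFun (adelicGroupData (↥(maximalRealSubfield L)) L (IsCMField.complexConj L) 3 H) fun g => Φ g j) (hΦ j)) =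
          ∑ i : Fin 2, (BallForms.isPullbackCocycle_cotangentCocycle.weightOf x₀ k⁻¹ (Pi.single i 1)) j • (MemLp.toLp (toQuotFun (adelicGroupData (↥(maximalRealSubfield L)) L (IsCMField.complexConj L) 3 H) fun g => Φ g i) (hΦ i))) ∧
        (∀ j, DifferentiableAt ℝ (fun b : Fin 2 → ℂ => (adelicGroupData (↥(maximalRealSubfield L)) L (IsCMField.complexConj L) 3 H).rightRegular μ (cmArchSection L ι H T hT (BallForms.expP b)) (MemLp.toLp (toQuotFun (adelicGroupData (↥(maximalRealSubfield L)) L (IsCMField.complexConj L) 3 H) fun g => Φ g j) (hΦ j))) 0) ∧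
        (∀ j, ∀ b : Fin 2 → ℂ,
          fderiv ℝ (fun b : Fin 2 → ℂ => (adelicGroupData (↥(maximalRealSubfield L)) L (IsCMField.complexConj L) 3 H).rightRegular μ (cmArchSection L ι H T hT (BallForms.expP b)) (MemLp.toLp (toQuotFun (adelicGroupData (↥(maximalRealSubfield L)) L (IsCMField.complexConj L) 3 H) fun g => Φ g j) (hΦ j))) 0 (Complex.I • b) =
            Complex.I • fderiv ℝ (fun b : Fin 2 → ℂ => (adelicGroupData (↥(maximalRealSubfield L)) L (IsCMField.complexConj L) 3 H).rightRegular μ (cmArchSection L ι H T hT (BallForms.expP b)) (MemLp.toLp (toQuotFun (adelicGroupData (↥(maximalRealSubfield L)) L (IsCMField.complexConj L) 3 H) fun g => Φ g j) (hΦ j))) 0 b))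
    (hR : ∀ (L : Type) [Field L] [NumberField L] [IsCMField L] (ι : L →+* ℂ) (H : Matrix (Fin 3) (Fin 3) L) (T : GL (Fin 3) ℂ)
      (hT : (T : Matrix (Fin 3) (Fin 3) ℂ)ᴴ * H.map ι * (T : Matrix (Fin 3) (Fin 3) ℂ) = Literature.Geometry.ComplexHyperbolic.BallModel.J),
      (∀ τ' : L →+* ℂ, InfinitePlace.mk τ' ≠ InfinitePlace.mk ι → (H.map τ').PosDef) →
      2 ≤ Module.finrank ℚ ↥(maximalRealSubfield L) →
      ∀ (μ : Measure (adelicGroupData (↥(maximalRealSubfield L)) L (IsCMField.complexConj L) 3 H).automorphicQuotient)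
        [(adelicGroupData (↥(maximalRealSubfield L)) L (IsCMField.complexConj L) 3 H).IsAutomorphicMeasure μ]
        (ν : Measure ↥U21) [ν.IsHaarMeasure] (A : ↥U21 → Matrix (Fin 2) (Fin 2) ℂ),
        (Continuous A ∧ HasCompactSupport A ∧
          (∀ (j i : Fin 2) (u' : ↥U21), ContDiff ℝ 1 fun b : Fin 2 → ℂ => A (BallForms.expP b * u') j i) ∧
          ∀ j i : Fin 2, Continuous fun p : (Fin 2 → ℂ) × ↥U21 => fderiv ℝ (fun b : Fin 2 → ℂ => A (BallForms.expP b * p.2) j i) p.1) →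
      ∀ (w : Fin 2 → (adelicGroupData (↥(maximalRealSubfield L)) L (IsCMField.complexConj L) 3 H).L2 μ),
        (∀ j, (∑ i : Fin 2, ∫ t, A t j i • (adelicGroupData (↥(maximalRealSubfield L)) L (IsCMField.complexConj L) 3 H).rightRegular μ (cmArchSection L ι H T hT t) (w i) ∂ν) = w j) →
        (∀ k ∈ cmCompactFactor L ι H T hT, ∀ j, (adelicGroupData (↥(maximalRealSubfield L)) L (IsCMField.complexConj L) 3 H).rightRegular μ k (w j) = w j) →
        (∃ Kf : Subgroup (finAdelic (↥(maximalRealSubfield L)) L (IsCMField.complexConj L) 3 H), IsOpen (Kf : Set (finAdelic (↥(maximalRealSubfield L)) L (IsCMField.complexConj L) 3 H)) ∧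
          ∀ k ∈ Kf, ∀ j, (adelicGroupData (↥(maximalRealSubfield L)) L (IsCMField.complexConj L) 3 H).rightRegular μ (finAdelicToAdelic (↥(maximalRealSubfield L)) L (IsCMField.complexConj L) 3 H k) (w j) = w j) →
        ∃ Ψ : Fin 2 → ((adelicGroupData (↥(maximalRealSubfield L)) L (IsCMField.complexConj L) 3 H).Adelic → ℂ), ∀ j,
          (∀ γ ∈ (adelicGroupData (↥(maximalRealSubfield L)) L (IsCMField.complexConj L) 3 H).quotientSubgroup, ∀ x, Ψ j (γ * x) = Ψ j x) ∧
            Continuous (Ψ j) ∧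
            toQuotFun (adelicGroupData (↥(maximalRealSubfield L)) L (IsCMField.complexConj L) 3 H) (Ψ j) =ᵐ[μ] (w j : (adelicGroupData (↥(maximalRealSubfield L)) L (IsCMField.complexConj L) 3 H).automorphicQuotient → ℂ) ∧
            (∀ y, DifferentiableAt ℝ (fun b : Fin 2 → ℂ => Ψ j (y * cmArchSection L ι H T hT (BallForms.expP b))) 0) ∧
            (∀ b : Fin 2 → ℂ, Continuous fun y => fderiv ℝ (fun b : Fin 2 → ℂ => Ψ j (y * cmArchSection L ι H T hT (BallForms.expP b))) 0 b) ∧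
            ∀ b : Fin 2 → ℂ,
              toQuotFun (adelicGroupData (↥(maximalRealSubfield L)) L (IsCMField.complexConj L) 3 H) (fun y => fderiv ℝ (fun b : Fin 2 → ℂ => Ψ j (y * cmArchSection L ι H T hT (BallForms.expP b))) 0 b) =ᵐ[μ]
                ((fderiv ℝ (fun b : Fin 2 → ℂ => (adelicGroupData (↥(maximalRealSubfield L)) L (IsCMField.complexConj L) 3 H).rightRegular μ (cmArchSection L ι H T hT (BallForms.expP b)) (w j)) 0 b : (adelicGroupData (↥(maximalRealSubfield L)) L (IsCMField.complexConj L) 3 H).L2 μ) :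
                  (adelicGroupData (↥(maximalRealSubfield L)) L (IsCMField.complexConj L) 3 H).automorphicQuotient → ℂ))
    (hC : Literature.NumberTheory.Rogawski1990.cohFinComponent_isTheta)
    (hC' : Literature.NumberTheory.Automorphic.Liu2021.Def411WeilCarriers.rhoAtLine_lineClassTransport)
    (hU4 : StubU4SignRule) (hJ3a : HJ3aType) (hocc : HoccType) :
    Summit.HodgeConjecture.HodgeConjecture.Theses.HCCMUnconditional.H413 :=
  P2H413OfSockets.H413_of_sockets' hC hC' (holCotFormSpectralProjection_of_KSR hK hS hR) hU4 hJ3a hocc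

end Summit.HodgeConjecture.HodgeConjecture.Cruxes.H413.F0P2dSocketDOfStubs

end
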